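import Summits.ResolutionOfSingularities.ResolutionOfSingularities.Theorems.PurelyInseparableDim4ChartAtlasSNCFarRepairTranslated
import Summits.ResolutionOfSingularities.ResolutionOfSingularities.Theorems.PurelyInseparableDim4ChartClosureSupport
import Summits.ResolutionOfSingularities.ResolutionOfSingularities.Theorems.PurelyInseparableDim4ChartClosureIdeal
import Summits.ResolutionOfSingularities.ResolutionOfSingularities.Theorems.PurelyInseparableDim4ChartAtlasCover
import Summits.ResolutionOfSingularities.ResolutionOfSingularities.Theorems.PurelyInseparableDim4MohAlongOrdAlongKept
import Literature.RingTheory.MvPolynomial.VariableIdeals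
import HarnessLib

/-!
# Purely inseparable four-folds `z^p + F(x₁, …, x₄)`: THE READING OF THE ESCAPING CENTRE AFTER THE FAR-RESONANCE REPAIR —
# chart, state, centre, exceptional component (chart model, one height; cell `res-dim4-pi`, typ-2 g8; HANDOFF g7 OPEN 4
# «post-repair readings: R2 p707037 transported», typ-3 memo S3c-V4 §13 (e)(i))

[OURS · counted 0] (D-0157 DOOR 2; DR-157-C.) Setting: the `x_j`-chart MODEL of an escaping step in its natural (cleaned, re-centred)
frame — hypersurface `z^p + F(y)`, escaping centre `Zc = V(y_0, y_T)` (`j ∉ T`, `F` `T`-permissible), a resonance height `h`, and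
the repair centre AT THAT HEIGHT `C_h = ψ_{−h}^* 𝓘(V(y_0, y_T, y_j))` (`V(C_h) = Zc ∩ {y_j = h}`; `ψ_t = Spec(y_j ↦ y_j + t)`), cf.
p717520 / p718376. For ANY blowing up `τ : V′ → 𝔸⁵` along `C_h`, `τ ≫ ψ_{−h}` is a blowing up along the coordinate centre
`V(y_0, y_T, y_j)` (p717520 `isBlowup_comp_spec_translate`), so `V′` carries the `y_j`-chart `𝔸⁵ → V′` of that blowing up. PROVED here
(no `sorry`, no new axiom):

* `span_clean_image_eq`, `comap_specMap_clean_𝓘Λ` — a cleaning automorphism `Θ` (`z ↦ z + g(y)`, `yᵢ ↦ yᵢ`) with `g ∈ (y_T)` FIXES the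
  ideal sheaf of `V(z, y_T)`;
* `clean_mem_span_X_of_step` — the cleaning polynomial of the tree's `CentreBlowup.step p (insert j T) j 0 s` lies in `(y_T)` whenever
  `T` is permissible for `s.F` and `j ∉ T` (both the point transform and the cleaned state are `T`-permissible, p721320
  `MohAlong.ordAlong_le_ordAlong_step_of_not_mem`; `g^p` is their difference; `(y_T)` is prime);
* **`farRepair_chart_reading`** — THE POST-REPAIR READING: there is a cleaning `Θ` such that on the chart
  `φ = Spec Θ ≫ (y_j-chart of τ ≫ ψ_{−h})`:
  (1) `St_τ(Zc)` reads `𝓘Λ_T = V(y_0, y_T)` and (2) `V(St_τ(Zc)) ⊆ φ(𝔸⁵)` — the strict transform of the escaping centre is a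
  SINGLE-CHART coordinate centre again (R2 p707037 + p693365, carried along the translation);
  (3) the controlled transform `τᶜ((z^p + F)·𝒪, p)` reads `(z^p + (CentreBlowup.step p (insert j T) j 0 s_h).F)·𝒪` for ANY presented state
  `s_h` with `s_h.F = F(y_j + h)` (`PointBlowup.translate (Pi.single j h) F`) — the tree's coordinate-centre STEP at the origin of the
  `y_j`-chart of the blow-up of `V(z, y_{T ∪ {j}})` in the frame translated to the height (p689648's ring-level dictionary);
  (4) the exceptional component `τ^*C_h` reads the coordinate hyperplane `y_j·𝒪`;
  and `T` stays permissible for the new state (p721320).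

So, in typ-3's v4 currency: after the sub-centre step at a member `c = V(z, y_T)` with repair index `j` and height `h`, the new node
`St(c)` has ONE main reading `(step p (insert j T) j 0 ⟨F(y_j + h), …⟩, T, …)` on a full affine chart. The readings of the old boundary
members on this chart are R2's (p707037, frame `c′ = −h`); the `W`-level transport is the companion file `…SNCFarRepairReadingW`.
Nothing here is a statement about resolution of singularities in dimension ≥ 4 / characteristic `p` (NOT proved anywhere in this
programme). bears_on: LADDER-RESOLUTION:D157-DOOR2 (res-dim4-pi). Supports stmt-ResolutionOfSingularities-16155 (helper).
-/

-- every declaration of this summit lives under `Summit.ResolutionOfSingularities.ResolutionOfSingularities`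
-- (summit = problem), which the duplicate-namespace linter flags; house convention (cf. the Target file).
set_option linter.dupNamespace false

noncomputable section

open MvPolynomial CategoryTheory AlgebraicGeometry TopologicalSpace
open AlgebraicGeometry.Scheme.IdealSheafData (ofIdealTop)

namespace Summit.ResolutionOfSingularities.ResolutionOfSingularities.Theorems.PIDim4

open Literature.AlgebraicGeometry.Resolution
open Literature.AlgebraicGeometry.Resolution.Hauser2010
open Literature.AlgebraicGeometry.Resolution.AffinePointBlowup (P A γ coord)

namespace ChartDictionary

/-! ## §1 A cleaning automorphism with cleaning polynomial in `(y_T)` fixes `V(z, y_T)` -/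

section Clean

variable {K : Type} [Field K] {T : Finset (Fin 4)} {Θ : A 4 K ≃ₐ[K] A 4 K} {g : MvPolynomial (Fin 4) K}

/-- `rename Fin.succ` carries `(yᵢ : i ∈ T) ⊆ K[y]` into the ideal `(z, yᵢ : i ∈ T) ⊆ K[z, y]`. -/
theorem rename_succ_mem_span_centreVars (hg : g ∈ Ideal.span (X '' (T : Set (Fin 4)) : Set (MvPolynomial (Fin 4) K))) :
    rename Fin.succ g ∈ Ideal.span (X '' (insert 0 (Fin.succ '' (T : Set (Fin 4)))) : Set (A 4 K)) := by
  have h1 : rename Fin.succ g ∈ (Ideal.span (X '' (T : Set (Fin 4)) : Set (MvPolynomial (Fin 4) K))).map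
      (rename Fin.succ : MvPolynomial (Fin 4) K →ₐ[K] A 4 K) := Ideal.mem_map_of_mem _ hg
  rw [Ideal.map_span] at h1
  refine Ideal.span_mono ?_ h1
  rintro _ ⟨_, ⟨i, hi, rfl⟩, rfl⟩
  exact ⟨i.succ, Set.mem_insert_of_mem _ ⟨i, hi, rfl⟩, (rename_X _ _).symm⟩

/-- **The generators of `(z, y_T)` and their images under a cleaning `Θ` (`z ↦ z + g`, `yᵢ ↦ yᵢ`, `g ∈ (y_T)`) span the same ideal.** -/
theorem span_clean_image_eq (h0 : Θ (X 0) = X 0 + rename Fin.succ g) (hs : ∀ i : Fin 4, Θ (X i.succ) = X i.succ)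
    (hg : g ∈ Ideal.span (X '' (T : Set (Fin 4)) : Set (MvPolynomial (Fin 4) K))) :
    Ideal.span ((fun i => Θ (X i)) '' (insert 0 (Fin.succ '' (T : Set (Fin 4)))) : Set (A 4 K)) =
      Ideal.span (X '' (insert 0 (Fin.succ '' (T : Set (Fin 4)))) : Set (A 4 K)) := by
  have hg' := rename_succ_mem_span_centreVars hg
  -- the `y`-generators are fixed, so `rename succ g` lies in both spans
  have hgΘ : rename Fin.succ g ∈ Ideal.span ((fun i => Θ (X i)) '' (insert 0 (Fin.succ '' (T : Set (Fin 4)))) : Set (A 4 K)) := by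
    have h1 : rename Fin.succ g ∈ Ideal.span (X '' (Fin.succ '' (T : Set (Fin 4))) : Set (A 4 K)) := by
      have h2 : rename Fin.succ g ∈ (Ideal.span (X '' (T : Set (Fin 4)) : Set (MvPolynomial (Fin 4) K))).map
          (rename Fin.succ : MvPolynomial (Fin 4) K →ₐ[K] A 4 K) := Ideal.mem_map_of_mem _ hg
      rw [Ideal.map_span, ← Set.image_comp] at h2
      refine Ideal.span_mono ?_ h2
      rintro _ ⟨i, hi, rfl⟩
      exact ⟨i.succ, ⟨i, hi, rfl⟩, (rename_X _ _).symm⟩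
    refine Ideal.span_mono ?_ h1
    rintro _ ⟨_, ⟨i, hi, rfl⟩, rfl⟩
    exact ⟨i.succ, Set.mem_insert_of_mem _ ⟨i, hi, rfl⟩, hs i⟩
  refine le_antisymm (Ideal.span_le.mpr ?_) (Ideal.span_le.mpr ?_)
  · rintro _ ⟨i, hi, rfl⟩
    dsimp only
    rcases Set.mem_insert_iff.mp hi with rfl | ⟨t, ht, rfl⟩
    · rw [SetLike.mem_coe, h0]
      exact Ideal.add_mem _ (Ideal.subset_span ⟨0, Set.mem_insert _ _, rfl⟩) hg'
    · rw [SetLike.mem_coe, hs t]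
      exact Ideal.subset_span ⟨t.succ, Set.mem_insert_of_mem _ ⟨t, ht, rfl⟩, rfl⟩
  · rintro _ ⟨i, hi, rfl⟩
    rcases Set.mem_insert_iff.mp hi with rfl | ⟨t, ht, rfl⟩
    · have e1 : (X 0 : A 4 K) = Θ (X 0) - rename Fin.succ g := by rw [h0, add_sub_cancel_right]
      rw [SetLike.mem_coe, e1]
      exact Ideal.sub_mem _ (Ideal.subset_span ⟨0, Set.mem_insert _ _, rfl⟩) hgΘ
    · rw [SetLike.mem_coe, ← hs t]
      exact Ideal.subset_span ⟨t.succ, Set.mem_insert_of_mem _ ⟨t, ht, rfl⟩, rfl⟩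

/-- **A cleaning automorphism with cleaning polynomial in `(y_T)` fixes the ideal sheaf of `V(z, y_T)`.** -/
theorem comap_specMap_clean_𝓘Λ (h0 : Θ (X 0) = X 0 + rename Fin.succ g) (hs : ∀ i : Fin 4, Θ (X i.succ) = X i.succ)
    (hg : g ∈ Ideal.span (X '' (T : Set (Fin 4)) : Set (MvPolynomial (Fin 4) K))) :
    (AffineCoordBlowup.𝓘Λ 4 K (insert 0 (Fin.succ '' (T : Set (Fin 4))))).comap (Spec.map (CommRingCat.ofHom (Θ : A 4 K →+* A 4 K))) =
      AffineCoordBlowup.𝓘Λ 4 K (insert 0 (Fin.succ '' (T : Set (Fin 4)))) := by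
  rw [𝓘Λ_eq_ofIdealTop, comap_ofIdealTop_of_isAffine, Ideal.map_span, ← Set.image_comp]
  have himg : ((Spec.map (CommRingCat.ofHom (Θ : A 4 K →+* A 4 K))).appTop.hom ∘ coord 4 K) ''
      (insert 0 (Fin.succ '' (T : Set (Fin 4)))) =
      (γ 4 K).symm '' ((fun i => Θ (X i)) '' (insert 0 (Fin.succ '' (T : Set (Fin 4))))) := by
    rw [← Set.image_comp]
    refine Set.image_congr fun i _ => ?_
    rw [Function.comp_apply, Function.comp_apply, show coord 4 K i = (γ 4 K).symm (X i) from rfl, appTop_specMap_γ_symm]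
    rfl
  have hcoord : coord 4 K '' (insert 0 (Fin.succ '' (T : Set (Fin 4)))) =
      (γ 4 K).symm '' (X '' (insert 0 (Fin.succ '' (T : Set (Fin 4))))) := by
    rw [← Set.image_comp]
    rfl
  rw [himg, hcoord, ← Ideal.map_span (γ 4 K).symm, ← Ideal.map_span (γ 4 K).symm, span_clean_image_eq h0 hs hg]

/-- The translation by `Fin.cases 0 0 = 0` is the identity. -/
theorem translate_cases_zero (P : A 4 K) : PointBlowup.translate (Fin.cases (0 : K) (0 : Fin 4 → K)) P = P := by
  have h : (Fin.cases (0 : K) (0 : Fin 4 → K) : Fin (4 + 1) → K) = 0 := by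
    funext i
    refine Fin.cases rfl (fun i => rfl) i
  rw [h, PointBlowup.translate_zero]

end Clean

/-! ## §2 The cleaning polynomial of a step INSIDE a permissible centre lies in the ideal of that centre -/

section CleanStep

variable {K : Type} [Field K] {p : ℕ} [hp : Fact p.Prime] [CharP K p] [DecidableEq K]
  {T : Finset (Fin 4)} {j : Fin 4} {Θ : A 4 K ≃ₐ[K] A 4 K} {g : MvPolynomial (Fin 4) K}

/-- **The cleaning polynomial of `CentreBlowup.step p (insert j T) j 0 s` lies in `(y_T)`** when `T` is permissible for `s.F` and `j ∉ T`:
with `Θ(z^p + F′) = z^p + (step …).F` (`F′` the chart transform; p689648's `h2`), `g^p = (step …).F − F′` and both are `T`-permissible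
(p721320), so `g^p ∈ (y_T)`, a prime ideal. -/
theorem clean_mem_span_X_of_step (hjT : j ∉ T) (h0 : Θ (X 0) = X 0 + rename Fin.succ g) (hs : ∀ i : Fin 4, Θ (X i.succ) = X i.succ)
    (s : State K) (hperm : (p : ℕ∞) ≤ CentreBlowup.ordAlong T s.F)
    (h2 : Θ (PointBlowup.translate (Fin.cases 0 (0 : Fin 4 → K)) (hyp p (CentreBlowup.chartTransform p (insert j T) j s.F))) =
      hyp p (CentreBlowup.step p (insert j T) j 0 s).F) :
    g ∈ Ideal.span (X '' (T : Set (Fin 4)) : Set (MvPolynomial (Fin 4) K)) := by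
  classical
  have hs' : ∀ i : Fin 4, Θ (X i.succ) = X i.succ + C ((0 : Fin 4 → K) i) := fun i => by rw [hs i, Pi.zero_apply, C_0, add_zero]
  rw [translate_cases_zero, clean_hyp_translate h0 hs', PointBlowup.translate_zero] at h2
  have hgp : g ^ p = (CentreBlowup.step p (insert j T) j 0 s).F - CentreBlowup.chartTransform p (insert j T) j s.F := by
    refine eq_sub_of_add_eq (rename_injective _ (Fin.succ_injective 4) (add_left_cancel (a := (X 0 : A 4 K) ^ p) ?_))
    have h3 := h2
    simp only [hyp] at h3
    exact h3
  -- both terms are `T`-permissible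
  have h1 : (p : ℕ∞) ≤ CentreBlowup.ordAlong T (CentreBlowup.step p (insert j T) j 0 s).F :=
    MohAlong.equimultiple_kept hjT (insert j T) (fun _ _ => rfl) hperm
  have h2' : (p : ℕ∞) ≤ CentreBlowup.ordAlong T (CentreBlowup.chartTransform p (insert j T) j s.F) :=
    hperm.trans (MohAlong.ordAlong_le_ordAlong_chartTransform_of_not_mem hjT p (insert j T) s.F)
  have hmem : g ^ p ∈ Ideal.span (X '' (T : Set (Fin 4)) : Set (MvPolynomial (Fin 4) K)) := by
    rw [hgp]
    exact Ideal.sub_mem _ (mem_span_X_of_le_ordAlong h1) (mem_span_X_of_le_ordAlong h2')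
  exact (Literature.RingTheory.MvPolynomial.isPrime_span_X_image (R := K) (T : Set (Fin 4))).mem_of_pow_mem p hmem

end CleanStep

/-! ## §3 The post-repair reading on the chart model (one height) -/

section Reading

variable {K : Type} [Field K] {p : ℕ} [hp : Fact p.Prime] [CharP K p]
  {T : Finset (Fin 4)} {j : Fin 4} {V' : Scheme.{0}} {τ : V' ⟶ P 4 K}

/-- `ψ_{−h}^* ψ_h^* = id` on ideal sheaves of `𝔸⁵`. -/
theorem comap_spec_translate_comap_spec_translate_neg (h : K) (D : Scheme.IdealSheafData (P 4 K)) :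
    (D.comap (Spec.map (CommRingCat.ofHom ((AffinePointBlowup.translateEquiv (n := 4) (Pi.single j.succ h) : A 4 K ≃ₐ[K] A 4 K) :
        A 4 K →+* A 4 K)))).comap
      (Spec.map (CommRingCat.ofHom ((AffinePointBlowup.translateEquiv (n := 4) (Pi.single j.succ (-h)) : A 4 K ≃ₐ[K] A 4 K) :
        A 4 K →+* A 4 K))) = D := by
  rw [← Scheme.IdealSheafData.comap_comp]
  have hc := spec_translate_single_comp (K := K) (j := j) (-h)
  rw [neg_neg] at hc
  rw [hc, Scheme.IdealSheafData.comap_id]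

/-- **Strict transforms along `τ` (centre `C_h`) are strict transforms along `τ ≫ ψ_{−h}` (centre `V(y_0, y_T, y_j)`) of the translated
data**: `St_τ(D) = St_{τ ≫ ψ_{−h}}(ψ_h^* D)`. -/
theorem strictTransformIdeal_height_eq (h : K) (D : Scheme.IdealSheafData (P 4 K)) :
    strictTransformIdeal τ ((AffineCoordBlowup.𝓘Λ 4 K (insert 0 (Fin.succ '' ((insert j T : Finset (Fin 4)) : Set (Fin 4))))).comap
        (Spec.map (CommRingCat.ofHom ((AffinePointBlowup.translateEquiv (n := 4) (Pi.single j.succ (-h)) : A 4 K ≃ₐ[K] A 4 K) :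
          A 4 K →+* A 4 K)))) D =
      strictTransformIdeal (τ ≫ Spec.map (CommRingCat.ofHom ((AffinePointBlowup.translateEquiv (n := 4) (Pi.single j.succ (-h)) :
          A 4 K ≃ₐ[K] A 4 K) : A 4 K →+* A 4 K)))
        (AffineCoordBlowup.𝓘Λ 4 K (insert 0 (Fin.succ '' ((insert j T : Finset (Fin 4)) : Set (Fin 4)))))
        (D.comap (Spec.map (CommRingCat.ofHom ((AffinePointBlowup.translateEquiv (n := 4) (Pi.single j.succ h) : A 4 K ≃ₐ[K] A 4 K) :
          A 4 K →+* A 4 K)))) := by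
  rw [strictTransformIdeal_comp_base, comap_spec_translate_comap_spec_translate_neg]

/-- **THE POST-REPAIR READING (chart model, one height).** `j ∉ T`, `F` `T`-permissible, `h : K`, `τ` ANY blowing up of `𝔸⁵` along
`C_h = ψ_{−h}^*𝓘(V(y_0, y_T, y_j))`; `s_h` any presented state with `s_h.F = F(y_j + h)`. There is a cleaning automorphism `Θ` (`z ↦ z + g`,
`yᵢ ↦ yᵢ`, `g ∈ (y_T)`) such that, on `φ = Spec Θ ≫ (y_j-chart of τ ≫ ψ_{−h})`: `St_τ(V(y_0, y_T))` reads `V(y_0, y_T)` and lies inside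
`φ(𝔸⁵)`; the controlled transform of `(z^p + F)·𝒪` reads `(z^p + (step p (insert j T) j 0 s_h).F)·𝒪`; `τ^*C_h` reads `y_j·𝒪`; and `T` is
permissible for the new state. -/
theorem farRepair_chart_reading [PerfectRing K p] [DecidableEq K] (hjT : j ∉ T) (h : K) (F : MvPolynomial (Fin 4) K)
    (hperm : (p : ℕ∞) ≤ CentreBlowup.ordAlong T F) (sₕ : State K) (hsₕ : sₕ.F = PointBlowup.translate (Pi.single j h) F)
    (hτ : IsBlowup τ ((AffineCoordBlowup.𝓘Λ 4 K (insert 0 (Fin.succ '' ((insert j T : Finset (Fin 4)) : Set (Fin 4))))).comap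
      (Spec.map (CommRingCat.ofHom ((AffinePointBlowup.translateEquiv (n := 4) (Pi.single j.succ (-h)) : A 4 K ≃ₐ[K] A 4 K) :
        A 4 K →+* A 4 K))))) :
    let Cₕ := (AffineCoordBlowup.𝓘Λ 4 K (insert 0 (Fin.succ '' ((insert j T : Finset (Fin 4)) : Set (Fin 4))))).comap
      (Spec.map (CommRingCat.ofHom ((AffinePointBlowup.translateEquiv (n := 4) (Pi.single j.succ (-h)) : A 4 K ≃ₐ[K] A 4 K) :
        A 4 K →+* A 4 K)))
    ∃ (Θ : A 4 K ≃ₐ[K] A 4 K) (g : MvPolynomial (Fin 4) K) (_ : IsIso (CommRingCat.ofHom (Θ : A 4 K →+* A 4 K))),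
      Θ (X 0) = X 0 + rename Fin.succ g ∧ (∀ i : Fin 4, Θ (X i.succ) = X i.succ) ∧
      g ∈ Ideal.span (X '' (T : Set (Fin 4)) : Set (MvPolynomial (Fin 4) K)) ∧
      let φ := Spec.map (CommRingCat.ofHom (Θ : A 4 K →+* A 4 K)) ≫
        AffineCoordBlowup.chartImm (isBlowup_comp_spec_translate hτ) (succ_mem_centreVars (Finset.mem_insert_self j T))
      (strictTransformIdeal τ Cₕ (AffineCoordBlowup.𝓘Λ 4 K (insert 0 (Fin.succ '' (T : Set (Fin 4)))))).comap φ =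
          AffineCoordBlowup.𝓘Λ 4 K (insert 0 (Fin.succ '' (T : Set (Fin 4)))) ∧
        ((strictTransformIdeal τ Cₕ (AffineCoordBlowup.𝓘Λ 4 K (insert 0 (Fin.succ '' (T : Set (Fin 4)))))).support : Set V') ⊆
          Set.range φ ∧
        (controlledTransform τ Cₕ (hypSheaf p F) p).comap φ = hypSheaf p (CentreBlowup.step p (insert j T) j 0 sₕ).F ∧
        (Cₕ.comap τ).comap φ = ofIdealTop (Ideal.span {(γ 4 K).symm (X j.succ + C 0)}) ∧
        (p : ℕ∞) ≤ CentreBlowup.ordAlong T (CentreBlowup.step p (insert j T) j 0 sₕ).F := by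
  intro Cₕ
  classical
  set Λ : Set (Fin (4 + 1)) := insert 0 (Fin.succ '' ((insert j T : Finset (Fin 4)) : Set (Fin 4))) with hΛ
  set ψm := Spec.map (CommRingCat.ofHom ((AffinePointBlowup.translateEquiv (n := 4) (Pi.single j.succ (-h)) : A 4 K ≃ₐ[K] A 4 K) :
    A 4 K →+* A 4 K)) with hψm
  set ψp := Spec.map (CommRingCat.ofHom ((AffinePointBlowup.translateEquiv (n := 4) (Pi.single j.succ h) : A 4 K ≃ₐ[K] A 4 K) :
    A 4 K →+* A 4 K)) with hψp
  have hτ' : IsBlowup (τ ≫ ψm) (AffineCoordBlowup.𝓘Λ 4 K Λ) := isBlowup_comp_spec_translate hτ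
  have hj : j ∈ insert j T := Finset.mem_insert_self j T
  -- permissibility of `insert j T` for the translated state
  have hpermT : (p : ℕ∞) ≤ CentreBlowup.ordAlong T sₕ.F := by
    rw [hsₕ, MohAlong.ordAlong_translate (Pi.single j h) (fun i hi => Pi.single_eq_of_ne (ne_of_mem_of_not_mem hi hjT) _) F]
    exact hperm
  have hpermI : (p : ℕ∞) ≤ CentreBlowup.ordAlong (insert j T) sₕ.F :=
    hpermT.trans (CentreBlowup.ordAlong_mono (Finset.subset_insert j T) _)
  -- the cleaning of record (p689648) at `b = 0`
  obtain ⟨Θ, g, h0, hs, h1, h2⟩ := exists_clean_translate_hyp_eq_step p hj (rfl : (0 : Fin 4 → K) j = 0) sₕ hpermI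
  have hg : g ∈ Ideal.span (X '' (T : Set (Fin 4)) : Set (MvPolynomial (Fin 4) K)) := clean_mem_span_X_of_step hjT h0 hs sₕ hpermT h2
  haveI hiso : IsIso (CommRingCat.ofHom (Θ : A 4 K →+* A 4 K)) := (inferInstance : IsIso Θ.toRingEquiv.toCommRingCatIso.hom)
  have hs' : ∀ i : Fin 4, Θ (X i.succ) = X i.succ + C ((0 : Fin 4 → K) i) := fun i => by rw [hs i, Pi.zero_apply, C_0, add_zero]
  have hread : Θ (coordBlowupSubst K Λ j.succ (hyp p sₕ.F)) = X j.succ ^ p * hyp p (CentreBlowup.step p (insert j T) j 0 sₕ).F := by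
    rw [← h1, translate_cases_zero]
  refine ⟨Θ, g, hiso, h0, hs, hg, ?_, ?_, ?_, ?_, MohAlong.equimultiple_kept hjT (insert j T) (fun _ _ => rfl) hpermT⟩
  · -- (1) the strict transform of the escaping centre reads `V(y_0, y_T)`
    rw [show strictTransformIdeal τ Cₕ (AffineCoordBlowup.𝓘Λ 4 K (insert 0 (Fin.succ '' (T : Set (Fin 4))))) =
        strictTransformIdeal (τ ≫ ψm) (AffineCoordBlowup.𝓘Λ 4 K Λ) (AffineCoordBlowup.𝓘Λ 4 K (insert 0 (Fin.succ '' (T : Set (Fin 4))))) by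
      rw [strictTransformIdeal_comp_base, comap_spec_translate_𝓘Λ_centre hjT], Scheme.IdealSheafData.comap_comp,
      comap_chartImm_strictTransform_escapingCentre_after_farRepair hjT hτ', comap_specMap_clean_𝓘Λ h0 hs hg]
  · -- (2) … and lives on this chart only
    rw [show strictTransformIdeal τ Cₕ (AffineCoordBlowup.𝓘Λ 4 K (insert 0 (Fin.succ '' (T : Set (Fin 4))))) =
        strictTransformIdeal (τ ≫ ψm) (AffineCoordBlowup.𝓘Λ 4 K Λ) (AffineCoordBlowup.𝓘Λ 4 K (insert 0 (Fin.succ '' (T : Set (Fin 4))))) by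
      rw [strictTransformIdeal_comp_base, comap_spec_translate_𝓘Λ_centre hjT]]
    intro x hx
    have hx' := support_strictTransform_escapingCentre_after_farRepair_subset hτ' hx
    rw [range_specMap_comp_chartImm]
    exact hx'
  · -- (3) the controlled transform reads the tree's STEP
    have hM : controlledTransform τ Cₕ (hypSheaf p F) p =
        ((⟨hypSheaf p sₕ.F, [], p⟩ : MarkedIdeal (P 4 K)).transform (τ ≫ ψm) (AffineCoordBlowup.𝓘Λ 4 K Λ)).ideal := by
      rw [MarkedIdeal.transform_ideal, controlledTransform_comp_base, hsₕ, ← comap_spec_translate_hypSheaf F h,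
        comap_spec_translate_comap_spec_translate_neg]
    rw [hM]
    exact comap_chart_transform_ideal_of_reading hj (rfl : (0 : Fin 4 → K) j = 0) h0 hs' hτ' hpermI hread _ rfl rfl
  · -- (4) the exceptional component reads `y_j·𝒪`
    rw [show Cₕ.comap τ = (AffineCoordBlowup.𝓘Λ 4 K Λ).comap (τ ≫ ψm) by rw [Scheme.IdealSheafData.comap_comp],
      Scheme.IdealSheafData.comap_comp, comap_chartImm_exceptional_after_farRepair hτ', comap_ofIdealTop_span_γ_symm, RingHom.coe_coe,
      C_0, add_zero, hs j]

end Reading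

end ChartDictionary

end Summit.ResolutionOfSingularities.ResolutionOfSingularities.Theorems.PIDim4

end
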